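import Summits.QuantumAdvantage.QuantumAdvantage.Theorems.ArithStatLadderIqThreeNotPPolyApexBQP
import Literature.Computability.AlgebraicComplexity.BurgisserThm41Proofs

/-!
# Crux `ArithStatLadder.IqThreeNotPPoly` (stmt-QuantumAdvantage-2422), line `Sketch` — THE EXACT SPLIT OF X

Continuation lead `prover-line-stmt-QuantumAdvantage-2422-c4-0`, second file (on top of
`ArithStatLadderIqThreeNotPPolyApexBQP.lean`, p117348: `SQF ∈ BQP`, `FUND ∈ P/poly ↔ SQF ∈ P/poly`).

* `iqThreeNotPPoly_iff_squarefree_or_promise` — **`X ↔ (SQF ∉ P/poly) ∨ PromiseX`**, where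
  `PromiseX` (stated inline, VERBATIM the disprover's `PromiseIqThreeNotPPoly` of
  `Cruxes/IqThreeNotPPoly/Disproof.lean` §3(a′) = ideator-2's statement) says that no polynomial-size
  `B₂` family computes `[3 ∣ h(−d)]` correctly on every fundamental `−d`. So the crux AS TYPED is
  EXACTLY "the factoring-family apex of line `Sketch` OR the factoring-free promise core": `←` by the
  landed squarefree-filter domination (`toLanguage_squarefree_mem_PPoly_of_iqThree_nagell`) resp.
  "a language decider is a promise decider" (`iqThreeNotPPoly_of_promiseCore`); `→` because a
  squarefreeness family yields a fundamentality family (`FUND ≤ₚ SQF`,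
  `fund_mem_PPoly_iff_squarefree_mem_PPoly`) whose AND with a promise decider decides `IQ3`
  (`iqThreeLang_eq_fund_inf_accepted`, `inter_mem_PPoly`).
* `quantumAdvantage_or_promise_of_iqThreeNotPPoly` — **`X → QuantumAdvantage ∨ PromiseX`**: whatever
  part of X does not already hand over the summit for free (squarefree branch, `SQF ∈ BQP`) is
  precisely the promise core.
* `quantumAdvantage_of_memBQP_of_promise` — the re-topped assembly `IqThreeMemBQP → PromiseX →
  QuantumAdvantage` (stronger than the route's `Assembly`, as `PromiseX → X`): the planner can
  replace X by its promise core without touching `closes`' logic.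

Theorems only; no new definition (the promise core is spelled out in each signature).
-/

set_option linter.dupNamespace false -- D-0017: single-problem summit ⇒ `QuantumAdvantage.QuantumAdvantage` by design

noncomputable section

namespace Summit.QuantumAdvantage.QuantumAdvantage.Theorems.IqThreeNotPPoly

open _root_.Computability Literature.Computability.Complexity
open Literature.Computability.Cryptography (IsNegFundamentalDiscr BQP)
open Literature.NumberTheory.QuadraticFields (BinaryQuadraticForm.classNumber)
open Summit.QuantumAdvantage.QuantumAdvantage.Theses.ArithStatLadder (IqThreeNotPPoly IqThreeMemBQP)

/-! ### The language cut out by a circuit family -/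

/-- Every `B₂` circuit family of polynomial size DECIDES SOME language in `P/poly`: the set of words it
accepts. [folklore] -/
theorem acceptedLang_mem_PPoly (p : Polynomial ℕ) (C : CircuitFamily)
    (hC : ∀ n, (C n).IsOver B2 ∧ (C n).size ≤ p.eval n) :
    ({x : List Bool | (C x.length).eval x.get = true} : Language Bool) ∈ PPoly := by
  refine Set.mem_iUnion.2 ⟨p, C, hC, fun x => ?_⟩
  by_cases hx : (C x.length).eval x.get = true
  · rw [hx]; symm
    exact (Set.mem_iff_boolIndicator ({x : List Bool | (C x.length).eval x.get = true} : Set _) x).1 hx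
  · rw [Bool.not_eq_true] at hx
    rw [hx]; symm
    exact (Set.notMem_iff_boolIndicator ({x : List Bool | (C x.length).eval x.get = true} : Set _) x).1
      (by simpa using hx)

/-- **A promise decider AND a fundamentality decider decide `IQ3`**: if a polynomial-size family `C`
computes `[3 ∣ h(−d)]` correctly on every fundamental `−d`, then `IQ3 = FUND ⊓ {C accepts}`. [folklore] -/
theorem iqThreeLang_eq_fund_inf_accepted (C : CircuitFamily)
    (hprom : ∀ d : ℕ, IsNegFundamentalDiscr d →
      (C (encodeNat d).length).eval (encodeNat d).get =
        decide (3 ∣ BinaryQuadraticForm.classNumber (-(d : ℤ)))) :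
    encodingNatBool.toLanguage
        {d : ℕ | IsNegFundamentalDiscr d ∧ 3 ∣ BinaryQuadraticForm.classNumber (-(d : ℤ))} =
      encodingNatBool.toLanguage {d : ℕ | IsNegFundamentalDiscr d} ⊓
        ({x : List Bool | (C x.length).eval x.get = true} : Language Bool) := by
  ext x
  change x ∈ _ ↔ x ∈ encodingNatBool.toLanguage {d : ℕ | IsNegFundamentalDiscr d} ∧
    x ∈ ({x : List Bool | (C x.length).eval x.get = true} : Set (List Bool))
  constructor
  · rintro ⟨d, ⟨hF, h3⟩, rfl⟩
    refine ⟨(encodeNat_mem_toLanguage_iff _ d).2 hF, ?_⟩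
    change (C (encodeNat d).length).eval (encodeNat d).get = true
    rw [hprom d hF, decide_eq_true_eq]
    exact h3
  · rintro ⟨⟨d, hF, rfl⟩, hacc⟩
    change IsNegFundamentalDiscr d at hF
    change (C (encodeNat d).length).eval (encodeNat d).get = true at hacc
    rw [hprom d hF, decide_eq_true_eq] at hacc
    exact (encodeNat_mem_toLanguage_iff _ d).2 ⟨hF, hacc⟩

/-- **`SQF ∈ P/poly` and a promise decider put `IQ3` in `P/poly`** (`FUND ∈ P/poly` by
`fund_mem_PPoly_iff_squarefree_mem_PPoly`, then intersect). [folklore] -/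
theorem iqThreeLang_mem_PPoly_of_squarefree_of_promiseDecider
    (hS : encodingNatBool.toLanguage {m : ℕ | Squarefree m} ∈ PPoly)
    (p : Polynomial ℕ) (C : CircuitFamily) (hC : ∀ n, (C n).IsOver B2 ∧ (C n).size ≤ p.eval n)
    (hprom : ∀ d : ℕ, IsNegFundamentalDiscr d →
      (C (encodeNat d).length).eval (encodeNat d).get =
        decide (3 ∣ BinaryQuadraticForm.classNumber (-(d : ℤ)))) :
    encodingNatBool.toLanguage
      {d : ℕ | IsNegFundamentalDiscr d ∧ 3 ∣ BinaryQuadraticForm.classNumber (-(d : ℤ))} ∈ PPoly := by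
  rw [iqThreeLang_eq_fund_inf_accepted C hprom]
  exact Literature.Computability.AlgebraicComplexity.inter_mem_PPoly
    (fund_mem_PPoly_iff_squarefree_mem_PPoly.2 hS) (acceptedLang_mem_PPoly p C hC)

/-- **`Promise ⇒ X`**: a decider of `IQ3` on all words is in particular correct on the promise (the
promise core is stated verbatim as the disprover's `PromiseIqThreeNotPPoly`). [folklore] -/
theorem iqThreeNotPPoly_of_promiseCore
    (hP : ¬ ∃ p : Polynomial ℕ, ∃ C : CircuitFamily, (∀ n, (C n).IsOver B2 ∧ (C n).size ≤ p.eval n) ∧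
      ∀ d : ℕ, IsNegFundamentalDiscr d →
        (C (encodeNat d).length).eval (encodeNat d).get =
          decide (3 ∣ BinaryQuadraticForm.classNumber (-(d : ℤ)))) : IqThreeNotPPoly := by
  intro hmem
  apply hP
  obtain ⟨p, hp⟩ := Set.mem_iUnion.1 hmem
  obtain ⟨C, hC, hdec⟩ := hp
  refine ⟨p, C, hC, fun d hd => ?_⟩
  -- the route's literal fundamentality conjunct is `IsNegFundamentalDiscr` by definition
  have hdec' : (C (encodeNat d).length).eval (encodeNat d).get =
      (encodingNatBool.toLanguage
        {d : ℕ | IsNegFundamentalDiscr d ∧ 3 ∣ BinaryQuadraticForm.classNumber (-(d : ℤ))}).boolIndicator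
        (encodeNat d) := hdec (encodeNat d)
  rw [hdec']
  have hiff : encodeNat d ∈ encodingNatBool.toLanguage
      {d : ℕ | IsNegFundamentalDiscr d ∧ 3 ∣ BinaryQuadraticForm.classNumber (-(d : ℤ))} ↔
      3 ∣ BinaryQuadraticForm.classNumber (-(d : ℤ)) := by
    rw [encodeNat_mem_toLanguage_iff]
    exact ⟨fun h' => h'.2, fun h' => ⟨hd, h'⟩⟩
  by_cases h3 : 3 ∣ BinaryQuadraticForm.classNumber (-(d : ℤ))
  · rw [decide_eq_true h3]
    exact (Set.mem_iff_boolIndicator _ _).1 (hiff.2 h3)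
  · rw [decide_eq_false h3]
    exact (Set.notMem_iff_boolIndicator _ _).1 (fun h' => h3 (hiff.1 h'))

/-- **THE EXACT SPLIT OF THE CRUX**: `X ↔ (SQF ∉ P/poly) ∨ PromiseX` — the crux AS TYPED is
"squarefreeness has no polynomial-size circuits OR no polynomial-size circuits compute `[3 ∣ h(−d)]`
on the fundamental `−d`" (the factoring-family apex of line `Sketch`, or the factoring-free promise
core). `←`: the landed squarefree-filter domination resp. `Promise ⇒ X`; `→`: a squarefreeness
family gives a fundamentality family (`FUND ≤ₚ SQF`), whose AND with a promise decider decides `IQ3`.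
[folklore] -/
theorem iqThreeNotPPoly_iff_squarefree_or_promise :
    IqThreeNotPPoly ↔
      (encodingNatBool.toLanguage {m : ℕ | Squarefree m} ∉ PPoly ∨
        ¬ ∃ p : Polynomial ℕ, ∃ C : CircuitFamily, (∀ n, (C n).IsOver B2 ∧ (C n).size ≤ p.eval n) ∧
          ∀ d : ℕ, IsNegFundamentalDiscr d →
            (C (encodeNat d).length).eval (encodeNat d).get =
              decide (3 ∣ BinaryQuadraticForm.classNumber (-(d : ℤ)))) := by
  constructor
  · intro hX
    by_contra h
    rw [not_or, not_not, not_not] at h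
    obtain ⟨hS, p, C, hC, hprom⟩ := h
    exact hX (iqThreeLang_mem_PPoly_of_squarefree_of_promiseDecider hS p C hC hprom)
  · rintro (hS | hP)
    · exact fun hIQ => hS (toLanguage_squarefree_mem_PPoly_of_iqThree_nagell hIQ)
    · exact iqThreeNotPPoly_of_promiseCore hP

/-- **What X is worth beyond the summit-for-free part**: `X → QuantumAdvantage ∨ PromiseX` — either
the crux already yields the summit outright (squarefree branch, `SQF ∈ BQP`), or what it asserts is
exactly the factoring-free promise core. [folklore] -/
theorem quantumAdvantage_or_promise_of_iqThreeNotPPoly (hX : IqThreeNotPPoly) :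
    QuantumAdvantage ∨
      ¬ ∃ p : Polynomial ℕ, ∃ C : CircuitFamily, (∀ n, (C n).IsOver B2 ∧ (C n).size ≤ p.eval n) ∧
        ∀ d : ℕ, IsNegFundamentalDiscr d →
          (C (encodeNat d).length).eval (encodeNat d).get =
            decide (3 ∣ BinaryQuadraticForm.classNumber (-(d : ℤ))) := by
  rcases iqThreeNotPPoly_iff_squarefree_or_promise.1 hX with hS | hP
  · exact Or.inl (quantumAdvantage_of_squarefree_not_mem_PPoly hS)
  · exact Or.inr hP

/-- **The re-topped assembly** (planner-facing): the quantum crux and the PROMISE CORE already give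
the summit — `IqThreeMemBQP → PromiseX → QuantumAdvantage` (if `BQP ⊆ BPP` then `IQ3 ∈ BPP ⊆ P/poly`
and a language decider is a promise decider). Stronger than the route's `Assembly` since
`PromiseX → X`. [folklore] -/
theorem quantumAdvantage_of_memBQP_of_promise (hQ : IqThreeMemBQP)
    (hP : ¬ ∃ p : Polynomial ℕ, ∃ C : CircuitFamily, (∀ n, (C n).IsOver B2 ∧ (C n).size ≤ p.eval n) ∧
      ∀ d : ℕ, IsNegFundamentalDiscr d →
        (C (encodeNat d).length).eval (encodeNat d).get =
          decide (3 ∣ BinaryQuadraticForm.classNumber (-(d : ℤ)))) : QuantumAdvantage := by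
  by_contra hQA
  refine iqThreeNotPPoly_of_promiseCore hP (BPP_subset_PPoly_holds ?_)
  by_contra hB
  exact hQA ⟨_, hQ, hB⟩

end Summit.QuantumAdvantage.QuantumAdvantage.Theorems.IqThreeNotPPoly

end
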